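import Literature.NumberTheory.GelbartRogawski1991.FiniteAdelicWeilCentralCoinvariantsZero
import Literature.NumberTheory.Automorphic.Liu2021.Def411WeilCarriersIrreducibleOfLemD1
import Literature.NumberTheory.Automorphic.Liu2021.LemD1AsPrintedTwist
import HarnessLib

/-!
# [Liu2021, Def. 4.11]'s central quotient `Coinv(Ω ∘ (u ↦ u·1_n), χ₁)` of the place-assembled Weil representation on a line pair
# is IRREDUCIBLE OR ZERO, from the local inputs — the rank-free form of the tree's `omega_center_isIrreducible_of_local`

Topic `NumberTheory/Automorphic/Liu2021`; namespaces `Literature.NumberTheory.Automorphic.Liu2021` (§1 glue),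
`Literature.RepresentationTheory.TwistedCoinv` (§1) and `Literature.NumberTheory.GelbartRogawski1991.UnitaryDualPair.WeilCoinv` (§2).
KERNEL ONLY: theorems, no definition, no named fact, no `sorry`; nothing of [Liu2021] is asserted.

WHY.  The tree transports [Liu2021, Def. 4.11]'s «irreducible» for `ω(μ, ε, χ) = ⊗'_v ω(μ_v, ε_v, χ_v)` from the places to the
global carrier under the hypothesis that EVERY local central quotient is irreducible (`WeilCoinv.omega_center_isIrreducible_of_local`,
[Flath1979]) — true for rank `n ≥ 3` by [Liu2021, App. D Lem. D.1 (1)].  At `n = 2` (App. D's unitary Shimura CURVE; the cell's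
registered d6 carrier `ω⋆`) Lem. D.1 (1) says the local factor «is zero if and only if `E_v` is a field, `V_v` is anisotropic (in
particular `n = 2`), and `χ̌_v = μ_v²`» (l. 5229): a local factor, hence `ω(μ, ε, χ)`, CAN BE ZERO, and Mathlib's `IsIrreducible`
(⊇ `Nontrivial`) fails for those `χ`.  The correct rank-free reading is Liu's own «irreducible OR ZERO»
(`Def411AsPrinted.IsIrreducibleOrZero`).  This file proves the rank-free transport:

* §1 glue — `IsIrreducibleOrZero` on a zero space, ⟺ `Subsingleton ∨ IsIrreducible`, along `comp` with a surjection, along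
  `AreIsomorphicRep`; `TwistedCoinv.subsingleton_coinv_of_forall_apply_eq` (pointwise-equal presentations, same zero quotient).
* §2 `WeilCoinv.omega_center_subsingleton_of_local` — ONE local central quotient zero ⇒ `Coinv(Ω ∘ (u ↦ u·1_n), χ₁) = 0`
  (★ `FinLocalSplittings.omega_centralCoinv_subsingleton`: ⊗' with a zero factor); `WeilCoinv.omega_center_isIrreducibleOrZero_of_local`
  — every local central quotient irreducible-or-zero and admissible, the unramified vector surviving off a finite set ⇒ the
  `U(J_V)(𝔸_f)`-action on `Coinv(Ω ∘ (u ↦ u·1_n), χ₁)` is IRREDUCIBLE OR ZERO (all local quotients non-zero: the ★ Flath road; else §2's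
  first theorem).

Sequel: `Def411WeilCarriersIrreducibleOrZeroAtLine.lean` (the local inputs at every place for `n ≥ 2`, and the head at the
χ-attached splitting — the d6 line's `ω⋆`).  HC_CM is proved only modulo the 7 printed citations until rung 0 closes; this file
discharges none of them and no interface fact.

## References
* [Liu2021] Y. Liu, *Fourier–Jacobi cycles and arithmetic relative trace formula*, Camb. J. Math. 9 (2021) = arXiv:2102.11518:
  Def. 4.11 (l. 2090–2096), App. D §D.1 Step 3 (l. 5221), Lem. D.1 first sentence + (1) (l. 5226–5229).
* [Flath1979] D. Flath, PSPM 33 (1979) part 1, §2, Theorem 2 / Example 2.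
* [Bump1997] D. Bump, *Automorphic forms and representations*, §4.2.
* [Mok2014] C. P. Mok, Mem. AMS 235 (2015), §1 Notation p. 5 (the centre of `U(N)`).
-/

set_option autoImplicit false

noncomputable section

open scoped Matrix Kronecker TensorProduct Classical RestrictedProduct
open NumberField NumberField.mixedEmbedding IsDedekindDomain Filter Set
open Literature.NumberTheory Literature.NumberTheory.Automorphic Literature.NumberTheory.Automorphic.UnitaryGroup
open Literature.NumberTheory.GelbartRogawski1991 Literature.NumberTheory.GelbartRogawski1991.UnitaryDualPair
open Literature.NumberTheory.GelbartRogawski1991.UnitaryDualPair.WeilCoinv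
open Literature.NumberTheory.Weil1964 Literature.RepresentationTheory
open Literature.RepresentationTheory.HeisenbergGroup
open Literature.GroupTheory.RestrictedProductCharacter
open Literature.NumberTheory.Automorphic.Liu2021

/-! ## §1 Glue: «irreducible or zero» on a zero space, along surjections, along isomorphisms; zero coinvariants -/

namespace Literature.NumberTheory.Automorphic.Liu2021

variable {G G' V V' : Type} [Group G] [Group G'] [AddCommGroup V] [Module ℂ V] [AddCommGroup V'] [Module ℂ V']

/-- a representation on a ZERO space is «irreducible or zero» (its only subrepresentation is `⊥ = ⊤`).
[cite: Liu2021, Def. 4.11 and Lemma D.1 (1)] -/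
theorem isIrreducibleOrZero_of_subsingleton [Subsingleton V] (ρ : Representation ℂ G V) : IsIrreducibleOrZero ρ :=
  fun W => by
    haveI : Subsingleton (Submodule ℂ V) := (Submodule.subsingleton_iff ℂ).2 ‹_›
    exact Or.inl (Subrepresentation.toSubmodule_injective (Subsingleton.elim _ _))

/-- «irreducible or zero» ⟺ (zero space) ∨ (Mathlib-irreducible). [cite: Liu2021, Def. 4.11 and Lemma D.1 (1)] -/
theorem isIrreducibleOrZero_iff_subsingleton_or_isIrreducible (ρ : Representation ℂ G V) :
    IsIrreducibleOrZero ρ ↔ Subsingleton V ∨ ρ.IsIrreducible := by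
  constructor
  · intro h
    by_cases hV : Nontrivial V
    · exact Or.inr (isIrreducible_of_nontrivial h)
    · exact Or.inl (not_nontrivial_iff_subsingleton.1 hV)
  · rintro (h | h)
    · exact isIrreducibleOrZero_of_subsingleton ρ
    · exact isIrreducibleOrZero_of_isIrreducible h

/-- «irreducible or zero» is invariant under pulling the group back along a SURJECTION `φ : G →* G'` (same space, same
lattice of subrepresentations: `Representation.exists_orderIso_subrepresentation_of_twist`). [cite: Liu2021, Def. 4.11 (l. 2096)] -/
theorem isIrreducibleOrZero_comp_iff_of_surjective (ρ : Representation ℂ G' V) (φ : G →* G')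
    (hφ : Function.Surjective φ) : IsIrreducibleOrZero (ρ.comp φ) ↔ IsIrreducibleOrZero ρ := by
  obtain ⟨Φ, -⟩ := Representation.exists_orderIso_subrepresentation_of_twist (ρ.comp φ) ρ φ hφ (LinearEquiv.refl ℂ V)
    (fun _ => 1) fun g v => by rw [Units.val_one, one_smul]; rfl
  constructor
  · intro h W'
    rcases h (Φ.symm W') with hW | hW
    · exact Or.inl (Φ.symm.injective (hW.trans Φ.symm.map_bot.symm))
    · exact Or.inr (Φ.symm.injective (hW.trans Φ.symm.map_top.symm))
  · intro h W
    rcases h (Φ W) with hW | hW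
    · exact Or.inl (Φ.injective (hW.trans Φ.map_bot.symm))
    · exact Or.inr (Φ.injective (hW.trans Φ.map_top.symm))

/-- «irreducible or zero» is invariant under isomorphism of representations (`AreIsomorphicRep`, the tree's reading of
Lem. D.1's «isomorphic»). [cite: Liu2021, App. D Lemma D.1 (2)–(4)] -/
theorem isIrreducibleOrZero_iff_of_areIsomorphicRep {ρ₁ : Representation ℂ G V} {ρ₂ : Representation ℂ G V'}
    (h : AreIsomorphicRep ρ₁ ρ₂) : IsIrreducibleOrZero ρ₁ ↔ IsIrreducibleOrZero ρ₂ := by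
  obtain ⟨f, hf⟩ := h
  exact isIrreducibleOrZero_iff_of_twist_equivariant ρ₁ ρ₂ f 1 fun g v => by
    rw [MonoidHom.one_apply, Units.val_one, one_smul]; exact hf g v

end Literature.NumberTheory.Automorphic.Liu2021

namespace Literature.RepresentationTheory.TwistedCoinv

/-- **two presentations of the same acting pair, pointwise equal, have the same (zero or not) coinvariant space**:
`ρW' = ρW` and `χ' = χ` pointwise ⇒ (`Coinv ρW χ = 0 ⇒ Coinv ρW' χ' = 0`) (the relation submodules coincide,
`ker_eq_of_forall_smul` at the unit twist `1`). [cite: Bump1997, §4.2 (twisting a representation by a character)] -/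
theorem subsingleton_coinv_of_forall_apply_eq {k H S : Type*} [Field k] [Group H] [AddCommGroup S] [Module k S]
    {ρW ρW' : Representation k H S} {χ χ' : H →* kˣ} (h : Subsingleton (Coinv ρW χ))
    (hρ : ∀ (x : H) (v : S), ρW' x v = ρW x v) (hχ : ∀ x : H, χ' x = χ x) : Subsingleton (Coinv ρW' χ') := by
  rw [Coinv, Submodule.Quotient.subsingleton_iff] at h ⊢
  rw [← h]
  exact ker_eq_of_forall_smul (fun _ => 1) (fun x v => by rw [Units.val_one, one_smul]; exact hρ x v)
    fun x => by rw [one_mul]; exact hχ x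

end Literature.RepresentationTheory.TwistedCoinv

/-! ## §2 The central coinvariants of the place-assembled `Ω` on the pair: zero, or irreducible, from local inputs -/

namespace Literature.NumberTheory.GelbartRogawski1991.UnitaryDualPair.WeilCoinv

variable (F E : Type) [Field F] [NumberField F] [Field E] [NumberField E] [Algebra F E]
variable (c : E ≃ₐ[F] E) (N : ℕ) {n : ℕ} (e : Fin N × Fin 1 ≃ Fin n)
variable (JV : Matrix (Fin N) (Fin N) E) (JW : Matrix (Fin 1) (Fin 1) E)
variable {TV : Matrix (Fin N) (Fin N) F} {TW : Matrix (Fin 1) (Fin 1) F}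
variable [Algebra.IsQuadraticExtension F E] {δ : E} (hcδ : c δ = -δ) (hδ : δ ≠ 0) {d : F}
  (hd : δ * δ = algebraMap F E d) (hV : TV.IsSymm) (hW : TW.IsSymm)
  (hJV : JV = TV.map (algebraMap F E)) (hJW : JW = TW.map (algebraMap F E)) (hJW0 : JW 0 0 ≠ 0)
  (𝓢 : LocalSplitting.FinLocalSplittings F E c n hcδ hδ hd (gram F e TV TW) (isSymm_gram F e hV hW)
    (reindex_kronecker_eq_gram_map F E e hJV hJW))

/-- **ONE local central quotient ZERO ⇒ the global central quotient `Coinv(Ω ∘ (u ↦ u·1_n), χ₁)` is ZERO** (line `W`,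
`χ₁` continuous; the ZERO twin of the tree's `omega_center_isIrreducible_of_local`).  INPUTS: `hx₀N` — `[1_{𝒪_vⁿ}] ≠ 0` off
a finite `S₁` ([Liu2021, Def. 4.11] «unramified for all but finitely many `v`»); `v₀` — a place whose local central
`χ_{1,v₀}`-quotient `Coinv(ω_{v₀} ∘ (local centre), χ_{1,v₀})` is zero ([Liu2021, App. D Lem. D.1 (1)], the `n = 2`
anisotropic case).  PROOF: the centre is `Πʳ(localCenter)` place by place and `χ₁ = ∏ χ_{1,v}`, so ★
`FinLocalSplittings.omega_centralCoinv_subsingleton` (⊗' with a zero factor) applies; the two presentations of the centre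
have the same coinvariant space (`TwistedCoinv.subsingleton_coinv_of_forall_apply_eq`).
[cite: Liu2021, Def. 4.11 (l. 2092–2096), App. D §D.1 Step 3 (l. 5221), Lem. D.1 (1) (l. 5229); Flath1979, §2  Example 2] -/
theorem omega_center_subsingleton_of_local {χ₁ : finAdelicOne F E c →* ℂˣ} (hχ₁ : Continuous χ₁)
    {S₁ : Finset (HeightOneSpectrum (𝓞 F))}
    (hx₀N : ∀ v ∉ S₁,
      TwistedCoinv.mk (show Representation ℂ (localPi E c 1 JW v) _ from
          (𝓢.omegaLoc v).comp (localCenter E c n (Matrix.reindex e e (JV ⊗ₖ JW)) JW hJW0 v))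
        (localCharOfCenter F E c JW hJW0 χ₁ v) (unitVec F (Fin n) v) ≠ 0)
    (v₀ : HeightOneSpectrum (𝓞 F))
    [Subsingleton (TwistedCoinv.Coinv (show Representation ℂ (localPi E c 1 JW v₀) _ from
        (𝓢.omegaLoc v₀).comp (localCenter E c n (Matrix.reindex e e (JV ⊗ₖ JW)) JW hJW0 v₀))
      (localCharOfCenter F E c JW hJW0 χ₁ v₀))] :
    Subsingleton (TwistedCoinv.Coinv (show Representation ℂ (finAdelicOne F E c) _ from
      𝓢.Omega.comp (finAdelicCenter F E c n (Matrix.reindex e e (JV ⊗ₖ JW)))) χ₁) := by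
  have hφ : ∀ᶠ v in cofinite, MapsTo (localCenter E c n (Matrix.reindex e e (JV ⊗ₖ JW)) JW hJW0 v)
      ((localInt E c 1 JW v : Subgroup (localPi E c 1 JW v)) : Set (localPi E c 1 JW v))
      ((localInt E c n (Matrix.reindex e e (JV ⊗ₖ JW)) v : Subgroup (localPi E c n (Matrix.reindex e e (JV ⊗ₖ JW)) v)) :
        Set (localPi E c n (Matrix.reindex e e (JV ⊗ₖ JW)) v)) :=
    Eventually.of_forall fun v => localCenter_mapsTo_localInt E c n (Matrix.reindex e e (JV ⊗ₖ JW)) JW hJW0 v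
  have hζ := finAdelicEquiv_comp_finAdelicCenter_surjective F E c JW hJW0
  -- §A: ⊗' with a zero factor, the centre acting through `ζ = finAdelicEquiv ∘ (u ↦ u·1_W)`
  have hA := 𝓢.omega_centralCoinv_subsingleton (fun v => localCenter E c n (Matrix.reindex e e (JV ⊗ₖ JW)) JW hJW0 v) hφ
    (χloc := fun v => localCharOfCenter F E c JW hJW0 χ₁ v)
    (charOfCenter F E c JW hJW0 χ₁) (coe_charOfCenter_eq_finprod F E c JW hJW0 hχ₁)
    (eventually_localCharOfCenter_eq_one F E c JW hJW0 hχ₁) hx₀N v₀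
    ((finAdelicEquiv F E c 1 JW).toMonoidHom.comp (finAdelicCenter F E c 1 JW)) hζ
  -- §B: `χ₁ ∘ ζ⁻¹ ∘ ζ = χ₁` and the two presentations of the centre agree pointwise: same coinvariant space
  exact TwistedCoinv.subsingleton_coinv_of_forall_apply_eq hA
    (fun u f => (𝓢.Omega_apply _ f).trans (congrArg (fun g => 𝓢.OmegaPi g f)
      (finAdelicEquiv_finAdelicCenter_eq_mapAlong F E c n (Matrix.reindex e e (JV ⊗ₖ JW)) JW hJW0 u)))
    fun u => (DFunLike.congr_fun (charOfCenter_comp F E c JW hJW0 χ₁) u).symm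

/-- **`Coinv(Ω ∘ (u ↦ u·1_n), χ₁)` with its `U(J_V)(𝔸_f)`-action `k ↦ Ω(reindex (k ⊗ 1))` is IRREDUCIBLE OR ZERO, from local
inputs** (line `W`, `χ₁` continuous).  HYPOTHESES (the printed local inputs of [Liu2021, Def. 4.11] at rank `n ≥ 2`, on the
tree's local carriers): `hirr`, `hadm` — every local central quotient `Coinv(ω_v ∘ (local centre), χ_{1,v})` with its
`U(J_{VW})(F_v)`-action is irreducible OR ZERO and admissible ([Liu2021, App. D Lem. D.1, first sentence l. 5227, with (1)
l. 5229 allowing zero]); `hx₀N` — `[1_{𝒪_vⁿ}] ≠ 0` off a finite `S₁`.  PROOF: either every local quotient is non-zero — then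
irreducible, and ★ `omega_center_isIrreducible_of_local` ([Flath1979]) — or one is zero, and `omega_center_subsingleton_of_local`.
[cite: Liu2021, Def. 4.11 (l. 2092–2096), App. D §D.1 Step 3 (l. 5221), Lem. D.1 (l. 5227; (1) l. 5229); Flath1979, Theorem 2 / Example 2] -/
theorem omega_center_isIrreducibleOrZero_of_local {χ₁ : finAdelicOne F E c →* ℂˣ} (hχ₁ : Continuous χ₁)
    {S₁ : Finset (HeightOneSpectrum (𝓞 F))}
    (hx₀N : ∀ v ∉ S₁,
      TwistedCoinv.mk (show Representation ℂ (localPi E c 1 JW v) _ from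
          (𝓢.omegaLoc v).comp (localCenter E c n (Matrix.reindex e e (JV ⊗ₖ JW)) JW hJW0 v))
        (localCharOfCenter F E c JW hJW0 χ₁ v) (unitVec F (Fin n) v) ≠ 0)
    (hirr : ∀ v, IsIrreducibleOrZero (TwistedCoinv.rep (localCharOfCenter F E c JW hJW0 χ₁ v) (𝓢.omegaLoc v)
      (commute_omegaLoc_localCenter F E c N e JV JW hcδ hδ hd hV hW hJV hJW hJW0 𝓢 v)))
    (hadm : ∀ v, (TwistedCoinv.rep (localCharOfCenter F E c JW hJW0 χ₁ v) (𝓢.omegaLoc v)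
      (commute_omegaLoc_localCenter F E c N e JV JW hcδ hδ hd hV hW hJV hJW hJW0 𝓢 v)).IsAdmissible) :
    IsIrreducibleOrZero (TwistedCoinv.rep χ₁
      (show Representation ℂ (finAdelic F E c N JV) _ from
        𝓢.Omega.comp ((finPairEmb F E c N 1 e JV JW).comp (MonoidHom.inl _ _)))
      (commute_omega_finPairEmb_finAdelicCenter F E c N e JV JW hcδ hδ hd hV hW hJV hJW 𝓢)) := by
  by_cases hnt : ∀ v, Nontrivial (TwistedCoinv.Coinv (show Representation ℂ (localPi E c 1 JW v) _ from
      (𝓢.omegaLoc v).comp (localCenter E c n (Matrix.reindex e e (JV ⊗ₖ JW)) JW hJW0 v)) (localCharOfCenter F E c JW hJW0 χ₁ v))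
  · -- every local quotient non-zero, hence irreducible: the Flath road
    exact isIrreducibleOrZero_of_isIrreducible
      (omega_center_isIrreducible_of_local F E c N e JV JW hcδ hδ hd hV hW hJV hJW hJW0 𝓢 hχ₁ hx₀N
        (fun v => by haveI := hnt v; exact isIrreducible_of_nontrivial (hirr v)) hadm)
  · -- one local quotient is zero: so is the global one
    obtain ⟨v₀, hv₀⟩ := not_forall.1 hnt
    haveI := not_nontrivial_iff_subsingleton.1 hv₀
    haveI := omega_center_subsingleton_of_local F E c N e JV JW hcδ hδ hd hV hW hJV hJW hJW0 𝓢 hχ₁ hx₀N v₀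
    exact isIrreducibleOrZero_of_subsingleton _

end Literature.NumberTheory.GelbartRogawski1991.UnitaryDualPair.WeilCoinv

end
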